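import Summits.CriticalPhenomena.PercolationContinuityZ3.Theorems.Transplant.PlanarSkeletonFrmFromDefs
import Summits.CriticalPhenomena.PercolationContinuityZ3.Theorems.Transplant.SkelFrmFromBParamsFaceFloorsAYA
import Summits.CriticalPhenomena.PercolationContinuityZ3.Theorems.Transplant.SkelFrmBParamsFaceFloorsAYA
import Summits.CriticalPhenomena.PercolationContinuityZ3.Theorems.Transplant.SkelFrmFromBParamsFaceFloorsTYA
import Summits.CriticalPhenomena.PercolationContinuityZ3.Theorems.Transplant.SkelFrmBParamsFaceFloorsTYA
import HarnessLib
import Summits.CriticalPhenomena.PercolationContinuityZ3.Theorems.Transplant.SkelFrmBParamsFaceFloorsYxE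
/-!
# U-WAVE PORT (RULING D-U, lead g21 2026-08-26; WAVE-U-MANIFEST v3.1 row «SkelFrmBParamsFaceFloorsYxE» ↦ «SkelFrmFromBParamsFaceFloorsYxE») of the tree module
# `Transplant/SkelFrmBParamsFaceFloorsYxE` onto the carrier `PlanarSkeletonFrmFrom` (frames only, cylinders connected from width `ℓ₀` on)

ORIGINAL TITLE: N2 (frames-only node, OPEN) — (F) column, (R-49)(c2b) VALUE LAYER part E0: **THE SECOND RUN's BOX ENVELOPES UP TO `600·Kq` REGIONS** (hp-8 g43)

builds on p205010 (kernel theorem, internal audit signed; external expert review pending) — nothing in this file uses p205010; NOTHING is claimed about the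
OPEN node U `SamePDropOfSkeletonFrmFrom₁` (nor U_s / the end state).  Lane `prim-bschramm`, seat `prim-bschramm-stmt` gen 26 (port pen, RULING M-11 family P-stmt; tool = p3-g26's port_u.py of record, registry-driven inputs); helper file
(`--supports stmt-CriticalPhenomena-4575 --as helper`).  PORT RULES r1–r4 of RULING D-U: declaration order and proof texts are those of the original,
byte-identical except (i) the carrier token `PlanarSkeletonFrm ↦ PlanarSkeletonFrmFrom` (binders, `namespace`/`end` lines, qualified names of twinned
declarations), (ii) carrier-FREE declarations of the original (φ-level `Skelφ…` blocks and namespace-only arithmetic residents) are NOT re-declared —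
this file imports the original and `export`s the twin-free residents (POLICY T / treatment (m1)); residents whose statement mentions a twinned
constant are copied, (iii) every carrier-binding declaration keeps its explicit binder `(Φ : PlanarSkeletonFrmFrom G)` in its own signature (r2).  Docstrings and citations are the original's.
-/

noncomputable section

open scoped Classical

namespace Summit.CriticalPhenomena.PercolationContinuityZ3.Theorems.Transplant

namespace PlanarSkeletonFrmFrom

namespace NegB

open Literature.Probability.Percolation Literature.Probability.LatticeModels SimpleGraph
open SkelConc (Consts)
open Skelφ (shearUnit shearUnit_pos yBoxLoS yBoxHiS ySLo ySHi yBnd)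
open Skelφ.StepI (DataN)
open TwoAxis.Para (modulus)
open Neg

namespace KS

/-- **The along extent of region `k` of a y′-run started at the one-stride window**, up to `600·Kq` regions: `u·(yBnd k + 2n_L) ≤ 9·u·(n_L·m)`. [folklore] -/
theorem yBnd_env600 (κ : Consts) {V : Type} [DecidableEq V] [Countable V] {G : SimpleGraph V} [G.LocallyFinite] (Φ : PlanarSkeletonFrmFrom G) (t : V) (p : unitInterval) (D : Skelφ.StepI.DataNS V) (g : ℕ) (f : ℕ) (mk : ℕ) (hN : EqNumL κ Φ t p D g f) (hκ : (hL κ Φ t p D g f).natAbs ≤ 10 * nL κ Φ t p D g f)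
    (hnA24 : 2400 * Neg.Kq κ * (KS0.R'0 κ Φ t p D mk + 2) ≤ nL κ Φ t p D g f) (hℓ : 22000 * Neg.Kq κ * (KS0.R'0 κ Φ t p D mk + 2) ≤ ℓL κ Φ t p D g f)
    {k : ℕ} (hk : k + 1 ≤ 600 * Neg.Kq κ) {u : ℤ} (hu : 0 ≤ u) :
    u * (yBnd (nL κ Φ t p D g f) (ℓL κ Φ t p D g f) (hL κ Φ t p D g f) (modulus (nL κ Φ t p D g f) (hL κ Φ t p D g f) (vL κ Φ t p D g f) (vβL κ Φ t p D g f))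
        (qB3XA κ Φ t p D g f (KS0.R'0 κ Φ t p D mk)) (KS0.R'0 κ Φ t p D mk) k + 2 * (nL κ Φ t p D g f : ℤ)) ≤
      9 * (u * ((nL κ Φ t p D g f : ℤ) * modulus (nL κ Φ t p D g f) (hL κ Φ t p D g f) (vL κ Φ t p D g f) (vβL κ Φ t p D g f))) := by
  have hnA : 2000 * Neg.Kq κ * (KS0.R'0 κ Φ t p D mk + 2) ≤ nL κ Φ t p D g f :=
    le_trans (Nat.mul_le_mul_right _ (Nat.mul_le_mul_right _ (by norm_num))) hnA24
  obtain ⟨hn1, hℓ1⟩ := one_le_of_eqNumL κ Φ t p D g f hN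
  have hmm := Skelφ.NegPrm.modulus_vβOf hn1 (hL κ Φ t p D g f) (ℓL κ Φ t p D g f) (vL κ Φ t p D g f)
  have e : vβL κ Φ t p D g f = Skelφ.NegPrm.vβOf (nL κ Φ t p D g f) (hL κ Φ t p D g f) (ℓL κ Φ t p D g f) (vL κ Φ t p D g f) := rfl
  rw [← e] at hmm
  obtain ⟨hm1, hm2⟩ := hmm
  obtain ⟨hW, -⟩ := Wrun_spec κ Φ t p D g f hn1
  obtain ⟨-, -, -, sLa⟩ := sY_spec κ Φ t p D g f hn1
  have hUe : (shearUnit (nL κ Φ t p D g f) (hL κ Φ t p D g f) : ℤ) = (nL κ Φ t p D g f : ℤ) + ((hL κ Φ t p D g f).natAbs : ℤ) := by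
    unfold Skelφ.shearUnit; push_cast; ring
  have h10 : (((hL κ Φ t p D g f).natAbs : ℕ) : ℤ) ≤ 10 * (nL κ Φ t p D g f : ℤ) := by exact_mod_cast hκ
  have hh0 : (0 : ℤ) ≤ ((hL κ Φ t p D g f).natAbs : ℤ) := Nat.cast_nonneg _
  have hℓ' : 22000 * (Neg.Kq κ : ℤ) * ((KS0.R'0 κ Φ t p D mk : ℤ) + 2) ≤ (ℓL κ Φ t p D g f : ℤ) := by exact_mod_cast hℓ
  have hnA' : 2000 * (Neg.Kq κ : ℤ) * ((KS0.R'0 κ Φ t p D mk : ℤ) + 2) ≤ (nL κ Φ t p D g f : ℤ) := by exact_mod_cast hnA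
  have hk' : (k : ℤ) + 1 ≤ 600 * (Neg.Kq κ : ℤ) := by exact_mod_cast hk
  have hq3 : ((qB3XA κ Φ t p D g f (KS0.R'0 κ Φ t p D mk) : ℕ) : ℤ) = (Wrun κ Φ t p D g f : ℤ) + 1000 * (Neg.Kq κ : ℤ) * (KS0.R'0 κ Φ t p D mk : ℤ) + 2 := by
    unfold qB3XA; push_cast; ring
  have hLa : yBnd (nL κ Φ t p D g f) (ℓL κ Φ t p D g f) (hL κ Φ t p D g f) (modulus (nL κ Φ t p D g f) (hL κ Φ t p D g f) (vL κ Φ t p D g f) (vβL κ Φ t p D g f))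
        (qB3XA κ Φ t p D g f (KS0.R'0 κ Φ t p D mk)) (KS0.R'0 κ Φ t p D mk) k =
      modulus (nL κ Φ t p D g f) (hL κ Φ t p D g f) (vL κ Φ t p D g f) (vβL κ Φ t p D g f) * (3 * (nL κ Φ t p D g f : ℤ) + ((k : ℤ) + 1) * (KS0.R'0 κ Φ t p D mk : ℕ)) +
        (nL κ Φ t p D g f : ℤ) * (shearUnit (nL κ Φ t p D g f) (hL κ Φ t p D g f) : ℤ) *
          (2 * (k : ℤ) + (qB3XA κ Φ t p D g f (KS0.R'0 κ Φ t p D mk) : ℕ) + ((k : ℤ) + 1) * (KS0.R'0 κ Φ t p D mk : ℕ) + (LaY κ Φ t p D g f : ℤ) + 2) := by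
    unfold Skelφ.yBnd LaY; push_cast; ring
  rw [hLa, hq3]
  clear hLa hq3 hℓ hnA hk hκ e
  have hn : (1 : ℤ) ≤ (nL κ Φ t p D g f : ℤ) := by exact_mod_cast hn1
  have hKq : (1 : ℤ) ≤ (Neg.Kq κ : ℤ) := by exact_mod_cast Neg.one_le_Kq κ
  have hR0 : (0 : ℤ) ≤ (KS0.R'0 κ Φ t p D mk : ℤ) := Nat.cast_nonneg _
  have hk0 : (0 : ℤ) ≤ (k : ℤ) := Nat.cast_nonneg _
  set U : ℤ := (shearUnit (nL κ Φ t p D g f) (hL κ Φ t p D g f) : ℤ)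
  set n : ℤ := (nL κ Φ t p D g f : ℤ)
  set ℓ : ℤ := (ℓL κ Φ t p D g f : ℤ)
  set m := modulus (nL κ Φ t p D g f) (hL κ Φ t p D g f) (vL κ Φ t p D g f) (vβL κ Φ t p D g f)
  set Q : ℤ := (Neg.Kq κ : ℤ)
  set R : ℤ := (KS0.R'0 κ Φ t p D mk : ℤ)
  set W : ℤ := (Wrun κ Φ t p D g f : ℤ)
  set La : ℤ := (LaY κ Φ t p D g f : ℤ)
  have hU11 : U ≤ 11 * n := by rw [hUe]; linarith
  have hUn : n ≤ U := by rw [hUe]; linarith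
  have hU0 : 0 ≤ U := by linarith
  have hm0 : 0 < m := by nlinarith
  have hQR : 0 ≤ Q * R := mul_nonneg (by linarith) hR0
  -- (a) `m·(k+1)·R ≤ m·600QR ≤ m·n/4` (`2400Q(R+2) ≤ n`)
  have a0 : ((k : ℤ) + 1) * R ≤ (600 * Q) * R := mul_le_mul_of_nonneg_right hk' hR0
  have a1 : m * (((k : ℤ) + 1) * R) ≤ m * ((600 * Q) * R) := mul_le_mul_of_nonneg_left a0 hm0.le
  have a1' : 4 * (m * ((600 * Q) * R)) ≤ m * n := by
    have h9 : 4 * ((600 * Q) * R) ≤ n := by nlinarith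
    have := mul_le_mul_of_nonneg_left h9 hm0.le
    linarith
  -- (b) the `U·(…)` block: `U·(2k + W + 1000QR + 2 + (k+1)R + La + 2) ≤ 4m + n·X` with `n·X ≤ m`
  have b1 : U * (1000 * Q * R) ≤ (11 * n) * (1000 * Q * R) := mul_le_mul_of_nonneg_right hU11 (mul_nonneg (by linarith) hR0)
  have b2 : U * (2 * (k : ℤ) + 4) ≤ (11 * n) * (2 * (600 * Q) + 4) := mul_le_mul hU11 (by linarith) (by linarith) (by linarith)
  have b3 : U * (((k : ℤ) + 1) * R) ≤ (11 * n) * ((600 * Q) * R) := mul_le_mul hU11 a0 (mul_nonneg (by linarith) hR0) (by linarith)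
  have key : n * (11000 * Q * R + 11 * (2 * (600 * Q) + 4) + 11 * ((600 * Q) * R) + 26) ≤ n * (ℓ - 1) := by
    refine mul_le_mul_of_nonneg_left ?_ (by linarith)
    nlinarith
  have hB : U * (2 * (k : ℤ) + (W + 1000 * Q * R + 2) + ((k : ℤ) + 1) * R + La + 2) ≤ 5 * m := by
    have e1 : U * (2 * (k : ℤ) + (W + 1000 * Q * R + 2) + ((k : ℤ) + 1) * R + La + 2) = U * (2 * (k : ℤ) + 4) + U * W + U * (1000 * Q * R) + U * (((k : ℤ) + 1) * R) + U * La := by ring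
    rw [e1]; linarith
  have hB' : n * (U * (2 * (k : ℤ) + (W + 1000 * Q * R + 2) + ((k : ℤ) + 1) * R + La + 2)) ≤ n * (5 * m) := mul_le_mul_of_nonneg_left hB (by linarith)
  have hn2 : 4 * (n * n) ≤ n * m := by
    have : n * (4 * n) ≤ n * m := mul_le_mul_of_nonneg_left (by nlinarith) (by linarith)
    linarith
  have htot : m * (3 * n + ((k : ℤ) + 1) * R) + n * U * (2 * (k : ℤ) + (W + 1000 * Q * R + 2) + ((k : ℤ) + 1) * R + La + 2) + 2 * n ≤ 9 * (n * m) := by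
    have e2 : n * U * (2 * (k : ℤ) + (W + 1000 * Q * R + 2) + ((k : ℤ) + 1) * R + La + 2) = n * (U * (2 * (k : ℤ) + (W + 1000 * Q * R + 2) + ((k : ℤ) + 1) * R + La + 2)) := by ring
    have e3 : m * (3 * n + ((k : ℤ) + 1) * R) = 3 * (n * m) + m * (((k : ℤ) + 1) * R) := by ring
    have hnn : n * 1 ≤ n * n := mul_le_mul_of_nonneg_left hn (by linarith)
    rw [e2, e3]; linarith
  have := mul_le_mul_of_nonneg_left htot hu
  linarith

/-- **The level error of region `k` of a y′-run started at the one-stride window**, up to `600·Kq` regions: `Err k + U ≤ 5m`. [folklore] -/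
theorem ySBox_err_le600 (κ : Consts) {V : Type} [DecidableEq V] [Countable V] {G : SimpleGraph V} [G.LocallyFinite] (Φ : PlanarSkeletonFrmFrom G) (t : V) (p : unitInterval) (D : Skelφ.StepI.DataNS V) (g : ℕ) (f : ℕ) (mk : ℕ) (hN : EqNumL κ Φ t p D g f) (hκ : (hL κ Φ t p D g f).natAbs ≤ 10 * nL κ Φ t p D g f)
    (hℓ : 22000 * Neg.Kq κ * (KS0.R'0 κ Φ t p D mk + 2) ≤ ℓL κ Φ t p D g f) {k : ℕ} (hk : k + 1 ≤ 600 * Neg.Kq κ) :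
    (2 * (k : ℤ) * (shearUnit (nL κ Φ t p D g f) (hL κ Φ t p D g f) : ℤ) + (shearUnit (nL κ Φ t p D g f) (hL κ Φ t p D g f) : ℤ) * (qB3XA κ Φ t p D g f (KS0.R'0 κ Φ t p D mk) : ℕ) +
          (shearUnit (nL κ Φ t p D g f) (hL κ Φ t p D g f) : ℤ) * (((k : ℤ) + 1) * (KS0.R'0 κ Φ t p D mk : ℕ)) + 3 * ((nL κ Φ t p D g f : ℤ) * ℓL κ Φ t p D g f) +
        shearUnit (nL κ Φ t p D g f) (hL κ Φ t p D g f)) + shearUnit (nL κ Φ t p D g f) (hL κ Φ t p D g f) ≤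
      5 * modulus (nL κ Φ t p D g f) (hL κ Φ t p D g f) (vL κ Φ t p D g f) (vβL κ Φ t p D g f) := by
  obtain ⟨hn1, hℓ1⟩ := one_le_of_eqNumL κ Φ t p D g f hN
  have hmm := Skelφ.NegPrm.modulus_vβOf hn1 (hL κ Φ t p D g f) (ℓL κ Φ t p D g f) (vL κ Φ t p D g f)
  have e : vβL κ Φ t p D g f = Skelφ.NegPrm.vβOf (nL κ Φ t p D g f) (hL κ Φ t p D g f) (ℓL κ Φ t p D g f) (vL κ Φ t p D g f) := rfl
  rw [← e] at hmm
  obtain ⟨hm1, hm2⟩ := hmm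
  obtain ⟨hW, -⟩ := Wrun_spec κ Φ t p D g f hn1
  have hUe : (shearUnit (nL κ Φ t p D g f) (hL κ Φ t p D g f) : ℤ) = (nL κ Φ t p D g f : ℤ) + ((hL κ Φ t p D g f).natAbs : ℤ) := by
    unfold Skelφ.shearUnit; push_cast; ring
  have h10 : (((hL κ Φ t p D g f).natAbs : ℕ) : ℤ) ≤ 10 * (nL κ Φ t p D g f : ℤ) := by exact_mod_cast hκ
  have hh0 : (0 : ℤ) ≤ ((hL κ Φ t p D g f).natAbs : ℤ) := Nat.cast_nonneg _
  have hℓ' : 22000 * (Neg.Kq κ : ℤ) * ((KS0.R'0 κ Φ t p D mk : ℤ) + 2) ≤ (ℓL κ Φ t p D g f : ℤ) := by exact_mod_cast hℓ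
  have hk' : (k : ℤ) + 1 ≤ 600 * (Neg.Kq κ : ℤ) := by exact_mod_cast hk
  have hq3 : ((qB3XA κ Φ t p D g f (KS0.R'0 κ Φ t p D mk) : ℕ) : ℤ) = (Wrun κ Φ t p D g f : ℤ) + 1000 * (Neg.Kq κ : ℤ) * (KS0.R'0 κ Φ t p D mk : ℤ) + 2 := by
    unfold qB3XA; push_cast; ring
  clear hℓ hk hκ
  rw [hq3]
  have hn : (1 : ℤ) ≤ (nL κ Φ t p D g f : ℤ) := by exact_mod_cast hn1
  have hKq : (1 : ℤ) ≤ (Neg.Kq κ : ℤ) := by exact_mod_cast Neg.one_le_Kq κ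
  have hR0 : (0 : ℤ) ≤ (KS0.R'0 κ Φ t p D mk : ℤ) := Nat.cast_nonneg _
  have hk0 : (0 : ℤ) ≤ (k : ℤ) := Nat.cast_nonneg _
  set U : ℤ := (shearUnit (nL κ Φ t p D g f) (hL κ Φ t p D g f) : ℤ)
  set n : ℤ := (nL κ Φ t p D g f : ℤ)
  set ℓ : ℤ := (ℓL κ Φ t p D g f : ℤ)
  set m := modulus (nL κ Φ t p D g f) (hL κ Φ t p D g f) (vL κ Φ t p D g f) (vβL κ Φ t p D g f)
  set Q : ℤ := (Neg.Kq κ : ℤ)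
  set R : ℤ := (KS0.R'0 κ Φ t p D mk : ℤ)
  set W : ℤ := (Wrun κ Φ t p D g f : ℤ)
  have hU11 : U ≤ 11 * n := by rw [hUe]; linarith
  have hUn : n ≤ U := by rw [hUe]; linarith
  have hU0 : 0 ≤ U := by linarith
  have hQR : 0 ≤ Q * R := mul_nonneg (by linarith) hR0
  -- `U·(W + 1000QR + 2) ≤ nℓ + U + 11n·1000QR + 2U`, `2kU ≤ 22n·(200Q+9)`, `U(k+1)R ≤ 11n(200Q+10)R`
  have a1 : U * (1000 * Q * R) ≤ (11 * n) * (1000 * Q * R) := mul_le_mul_of_nonneg_right hU11 (mul_nonneg (by linarith) hR0)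
  have a2 : 2 * (k : ℤ) * U ≤ 2 * (600 * Q) * (11 * n) := by nlinarith
  have a3 : U * (((k : ℤ) + 1) * R) ≤ (11 * n) * ((600 * Q) * R) := mul_le_mul hU11 (mul_le_mul_of_nonneg_right hk' hR0) (mul_nonneg (by linarith) hR0) (by linarith)
  -- the ℓ floor: `n·(…) ≤ n·(ℓ − 1) < m`
  have key : n * (2 * (600 * Q) * 11 + 11000 * Q * R + 11 * ((600 * Q) * R) + 60) ≤ n * (ℓ - 1) := by
    refine mul_le_mul_of_nonneg_left ?_ (by linarith)
    nlinarith
  nlinarith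

end KS

end NegB

end PlanarSkeletonFrmFrom

end Summit.CriticalPhenomena.PercolationContinuityZ3.Theorems.Transplant

end
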